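import Summits.AtomisticToContinuum.BoseEinsteinCondensation.Theses.BECConjugateDomination
import Literature.MathematicalPhysics.QuantumManyBody.PairCubeCounting

/-!
# Route `BECConjugateDomination`, crux `PuffFloor` (stmt-AtomisticToContinuum-11785),
# line `coupling-slope-pocket`, stub S1: classical stability of the pocket potential

Supports (does not close) stmt-AtomisticToContinuum-11785. For a smooth-class pair profile `v`
(finite, `C²` as `ṽ(x) = v(|x|)`, edge condition `‖D²ṽ‖ ≤ Cₑ√ṽ`, positive soft core `v(0) > 0`,
range `R₀`) the Puff weight profile `W(r) = r²‖D²ṽ(r e₀)‖` satisfies, for `0 < t ≤ t₁` and every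
configuration of `N` points of `ℝ³`,
`t ∑_{i<j} W(|xᵢ - xⱼ|) ≤ ∑_{i<j} v(|xᵢ - xⱼ|) + B t² N`,
i.e. the pocket potential `v − tW` is classically stable (Lee 2009, Def. 2) with constant `B t²`.

Proof: the edge condition and `2ab ≤ a² + b²` give the pointwise bound
`t W(r) ≤ v(r)/4 + D₀ t² 1_{r ≤ R₀}` and `W(r) = 0` for `r > R₀`; continuity of `ṽ` at `0` gives a
core `v ≥ v₀ > 0` on `[0, r₁)`; the cube counting `pair_count_le` of
`Literature/MathematicalPhysics/QuantumManyBody/PairCubeCounting.lean` (half-open cube tiling of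
mesh `r₁/2`, fibrewise count `#{(i,j) : cubes within K₀} ≤ 2(2K₀+1)³ #{(i,j) : same cube}`) pays
the shallow pocket from the core. Purely classical: finite sums over pairs of points, no integrals.

References: J. O. Lee, *Ground state energy of dilute Bose gas in small negative potential case*,
J. Stat. Phys. 134 (2009), arXiv:0803.0533, Def. 2; D. Ruelle, *Statistical Mechanics* (1969) §3.2
(stability from a positive core); card `Ideas/coupling-slope-pocket.md`, Tier 1.
-/

noncomputable section

namespace Summit.AtomisticToContinuum.BoseEinsteinCondensation.Theorems

open MeasureTheory Filter
open scoped ENNReal NNReal BigOperators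
open Literature.MathematicalPhysics.QuantumManyBody.BoseGas
open Summit.AtomisticToContinuum.BoseEinsteinCondensation.Theses.BECConjugateDomination

namespace PocketClassicalStability

/-! ## Pointwise bounds on the Puff weight profile -/

/-- **Profile bounds.** For a finite profile `v` with `ṽ(x) = v(|x|)` of class `C²`, edge
condition `‖D²ṽ‖ ≤ Cₑ√ṽ`, `v(0) > 0` and range `R₀`, the Puff weight
`W(r) = r²‖D²ṽ(r e₀)‖` satisfies: (core) `v ≥ v₀ > 0` on `[0, r₁)` for some `r₁ > 0`
(continuity of `ṽ` at `0`); (pocket) `t W(r) ≤ v(r)/4 + D₀ t² 1_{r ≤ R₀}` for `r ≥ 0`, `t > 0`,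
with `D₀ = R₀⁴ max(Cₑ,1)² + 1` — from `W(r) ≤ R₀² Cₑ √v(r)` (edge condition, `|r e₀| = r`),
`2ab ≤ a² + b²`, and `D²ṽ(r e₀) = 0` for `r > R₀` (`ṽ` vanishes on the open set `{|y| > R₀}`).
[folklore] -/
theorem profile_bounds (v : ℝ → ℝ≥0∞) (hfin : ∀ r, v r ≠ ⊤)
    (hC2 : ContDiff ℝ 2 (fun x : Space => (v ‖x‖).toReal)) (Cₑ : ℝ)
    (hCₑ : ∀ x : Space, ‖iteratedFDeriv ℝ 2 (fun x : Space => (v ‖x‖).toReal) x‖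
      ≤ Cₑ * Real.sqrt ((v ‖x‖).toReal))
    (hcore : 0 < v 0) (R₀ : ℝ) (hrange : ∀ r, R₀ < r → v r = 0) :
    ∃ r₁ D₀ v₀ : ℝ, 0 < r₁ ∧ 0 < D₀ ∧ 0 < v₀ ∧
      (∀ r, 0 ≤ r → r < r₁ → v₀ ≤ (v r).toReal) ∧
      (∀ r, 0 ≤ r → ∀ t, 0 < t →
        t * (r ^ 2 * ‖iteratedFDeriv ℝ 2 (fun x : Space => (v ‖x‖).toReal)
              (r • EuclideanSpace.single (0 : Fin 3) (1 : ℝ))‖)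
          ≤ (v r).toReal / 4 + D₀ * t ^ 2 * (if r ≤ R₀ then 1 else 0)) := by
  set vt : Space → ℝ := fun x => (v ‖x‖).toReal with hvt
  set e₀ : Space := EuclideanSpace.single (0 : Fin 3) (1 : ℝ) with he₀
  have hnorm : ∀ r : ℝ, ‖r • e₀‖ = |r| := fun r => by
    rw [norm_smul, he₀, PiLp.norm_single, norm_one, mul_one, Real.norm_eq_abs]
  have hvt_ray : ∀ r, 0 ≤ r → vt (r • e₀) = (v r).toReal := fun r hr => by
    simp only [hvt]
    rw [hnorm, abs_of_nonneg hr]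
  set C := max Cₑ 1 with hC
  have hedgeC : ∀ x, ‖iteratedFDeriv ℝ 2 vt x‖ ≤ C * Real.sqrt (vt x) := fun x =>
    (hCₑ x).trans (mul_le_mul_of_nonneg_right (le_max_left _ _) (Real.sqrt_nonneg _))
  -- the second derivative vanishes outside the range
  have hD0 : ∀ r, R₀ < r → iteratedFDeriv ℝ 2 vt (r • e₀) = 0 := by
    intro r hr
    have hopen : IsOpen {y : Space | R₀ < ‖y‖} := isOpen_lt continuous_const continuous_norm
    have hmem : r • e₀ ∈ {y : Space | R₀ < ‖y‖} := by
      show R₀ < ‖r • e₀‖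
      rw [hnorm]
      exact hr.trans_le (le_abs_self r)
    have hev : vt =ᶠ[nhds (r • e₀)] fun _ => (0 : ℝ) :=
      Filter.eventually_of_mem (hopen.mem_nhds hmem) fun y hy => by
        show (v ‖y‖).toReal = 0
        rw [hrange _ hy, ENNReal.toReal_zero]
    rw [(hev.iteratedFDeriv ℝ 2).eq_of_nhds, iteratedFDeriv_fun_zero]
    rfl
  -- the core, by continuity at the origin
  have hcont : Continuous fun r : ℝ => vt (r • e₀) :=
    hC2.continuous.comp (continuous_id.smul continuous_const)
  have hv0 : 0 < (v 0).toReal := ENNReal.toReal_pos hcore.ne' (hfin 0)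
  obtain ⟨δ, hδ, hδ'⟩ := Metric.continuous_iff.1 hcont 0 ((v 0).toReal / 2) (by positivity)
  refine ⟨δ, R₀ ^ 4 * C ^ 2 + 1, (v 0).toReal / 2, hδ, by positivity, by positivity, ?_, ?_⟩
  · intro r hr0 hr
    have h := hδ' r (by rwa [Real.dist_eq, sub_zero, abs_of_nonneg hr0])
    rw [hvt_ray r hr0, zero_smul, Real.dist_eq] at h
    have h0 : vt 0 = (v 0).toReal := by
      simp only [hvt]
      rw [norm_zero]
    rw [h0] at h
    have := (abs_lt.1 h).1
    linarith
  · intro r hr0 t ht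
    by_cases hr : r ≤ R₀
    · rw [if_pos hr, mul_one]
      have h1 : ‖iteratedFDeriv ℝ 2 vt (r • e₀)‖ ≤ C * Real.sqrt ((v r).toReal) := by
        have := hedgeC (r • e₀)
        rwa [hvt_ray r hr0] at this
      have h2 : r ^ 2 ≤ R₀ ^ 2 := pow_le_pow_left₀ hr0 hr 2
      have hs := Real.sq_sqrt (ENNReal.toReal_nonneg : 0 ≤ (v r).toReal)
      have h3 : t * (r ^ 2 * ‖iteratedFDeriv ℝ 2 vt (r • e₀)‖)
          ≤ t * (R₀ ^ 2 * (C * Real.sqrt ((v r).toReal))) :=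
        mul_le_mul_of_nonneg_left (mul_le_mul h2 h1 (norm_nonneg _) (sq_nonneg _)) ht.le
      have key : t * (R₀ ^ 2 * (C * Real.sqrt ((v r).toReal)))
          ≤ Real.sqrt ((v r).toReal) ^ 2 / 4 + (R₀ ^ 4 * C ^ 2 + 1) * t ^ 2 := by
        nlinarith [sq_nonneg (Real.sqrt ((v r).toReal) - 2 * t * R₀ ^ 2 * C), sq_nonneg t]
      calc t * (r ^ 2 * ‖iteratedFDeriv ℝ 2 vt (r • e₀)‖)
          ≤ t * (R₀ ^ 2 * (C * Real.sqrt ((v r).toReal))) := h3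
        _ ≤ Real.sqrt ((v r).toReal) ^ 2 / 4 + (R₀ ^ 4 * C ^ 2 + 1) * t ^ 2 := key
        _ = (v r).toReal / 4 + (R₀ ^ 4 * C ^ 2 + 1) * t ^ 2 := by rw [hs]
    · rw [if_neg hr, mul_zero, add_zero, hD0 r (not_le.1 hr), norm_zero, mul_zero, mul_zero]
      positivity

/-! ## Assembly over the reals -/

/-- **Real form of the stability estimate.** If `U ≥ 0`, `U ≥ v₀ > 0` on `[0, r₁)`,
`t W(r) ≤ U(r)/4 + D₀ t² 1_{r ≤ R₀}` for `r ≥ 0`, `t > 0`, and the cube count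
`#{i<j : |xᵢⱼ| ≤ R₀} ≤ K (#{i<j : |xᵢⱼ| < r₁} + N)` holds, then for
`t ≤ t₁ = min 1 (v₀ / (8 (K+1) D₀))`:
`t ∑_{i<j} W(|xᵢⱼ|) ≤ ∑_{i<j} U(|xᵢⱼ|) + K D₀ t² N`. [folklore] -/
theorem real_stability {W U : ℝ → ℝ} {r₁ D₀ v₀ R₀ K : ℝ} (hD₀ : 0 < D₀) (hv₀ : 0 < v₀)
    (hK : 0 ≤ K) (hU : ∀ r, 0 ≤ U r) (hcoreR : ∀ r, 0 ≤ r → r < r₁ → v₀ ≤ U r)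
    (hpt : ∀ r, 0 ≤ r → ∀ t, 0 < t →
      t * W r ≤ U r / 4 + D₀ * t ^ 2 * (if r ≤ R₀ then 1 else 0))
    (hcount : ∀ (N : ℕ) (X : Config N),
      (∑ i, ∑ j with i < j, if dist (X i) (X j) ≤ R₀ then (1 : ℝ) else 0)
        ≤ K * ((∑ i, ∑ j with i < j, if dist (X i) (X j) < r₁ then (1 : ℝ) else 0) + N)) :
    ∃ t₁ B : ℝ, 0 < t₁ ∧ 0 ≤ B ∧ ∀ t : ℝ, 0 < t → t ≤ t₁ → ∀ (N : ℕ) (X : Config N),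
      t * ∑ i, ∑ j with i < j, W (dist (X i) (X j))
        ≤ (∑ i, ∑ j with i < j, U (dist (X i) (X j))) + B * t ^ 2 * N := by
  refine ⟨min 1 (v₀ / (8 * (K + 1) * D₀)), K * D₀, lt_min one_pos (by positivity),
    by positivity, ?_⟩
  intro t ht ht₁ N X
  have ht1 : t ≤ 1 := ht₁.trans (min_le_left _ _)
  have ht2 : t ≤ v₀ / (8 * (K + 1) * D₀) := ht₁.trans (min_le_right _ _)
  have htt : t ^ 2 ≤ v₀ / (8 * (K + 1) * D₀) := by nlinarith
  have hkey : 2 * K * D₀ * t ^ 2 ≤ v₀ / 4 := by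
    have hpos : 0 < 8 * (K + 1) * D₀ := by positivity
    have h8 : 8 * (K + 1) * D₀ * t ^ 2 ≤ v₀ := by
      calc 8 * (K + 1) * D₀ * t ^ 2 ≤ 8 * (K + 1) * D₀ * (v₀ / (8 * (K + 1) * D₀)) := by
            gcongr
        _ = v₀ := by field_simp
    nlinarith [sq_nonneg t]
  set SW := ∑ i, ∑ j with i < j, W (dist (X i) (X j)) with hSW
  set SU := ∑ i, ∑ j with i < j, U (dist (X i) (X j)) with hSU
  set Pn := ∑ i, ∑ j with i < j, if dist (X i) (X j) ≤ R₀ then (1 : ℝ) else 0 with hPn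
  set Pc := ∑ i, ∑ j with i < j, if dist (X i) (X j) < r₁ then (1 : ℝ) else 0 with hPc
  have hS1 : t * SW ≤ SU / 4 + D₀ * t ^ 2 * Pn := by
    have e1 : t * SW = ∑ i, ∑ j with i < j, t * W (dist (X i) (X j)) := by
      simp only [hSW, Finset.mul_sum]
    have e2 : SU / 4 + D₀ * t ^ 2 * Pn = ∑ i, ∑ j with i < j,
        (U (dist (X i) (X j)) / 4 + D₀ * t ^ 2 * (if dist (X i) (X j) ≤ R₀ then 1 else 0)) := by
      simp only [hSU, hPn, Finset.sum_add_distrib, Finset.mul_sum, Finset.sum_div]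
    rw [e1, e2]
    exact Finset.sum_le_sum fun i _ => Finset.sum_le_sum fun j _ => hpt _ dist_nonneg t ht
  have hS2 : v₀ * Pc ≤ SU := by
    have e1 : v₀ * Pc = ∑ i, ∑ j with i < j,
        v₀ * (if dist (X i) (X j) < r₁ then (1 : ℝ) else 0) := by
      simp only [hPc, Finset.mul_sum]
    rw [e1]
    refine Finset.sum_le_sum fun i _ => Finset.sum_le_sum fun j _ => ?_
    split_ifs with h
    · rw [mul_one]
      exact hcoreR _ dist_nonneg h
    · rw [mul_zero]
      exact hU _
  have hS3 : Pn ≤ K * (Pc + N) := hcount N X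
  have hSU0 : 0 ≤ SU := Finset.sum_nonneg fun i _ => Finset.sum_nonneg fun j _ => hU _
  have hPc0 : 0 ≤ Pc :=
    Finset.sum_nonneg fun i _ => Finset.sum_nonneg fun j _ => by split_ifs <;> norm_num
  have hN : (0 : ℝ) ≤ N := Nat.cast_nonneg N
  have hA : D₀ * t ^ 2 * Pn ≤ D₀ * t ^ 2 * (K * (Pc + N)) :=
    mul_le_mul_of_nonneg_left hS3 (by positivity)
  have hB : K * D₀ * t ^ 2 * Pc ≤ v₀ / 8 * Pc :=
    mul_le_mul_of_nonneg_right (by linarith) hPc0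
  calc t * SW ≤ SU / 4 + D₀ * t ^ 2 * Pn := hS1
    _ ≤ SU / 4 + D₀ * t ^ 2 * (K * (Pc + N)) := by linarith
    _ = SU / 4 + K * D₀ * t ^ 2 * Pc + K * D₀ * t ^ 2 * N := by ring
    _ ≤ SU / 4 + v₀ / 8 * Pc + K * D₀ * t ^ 2 * N := by linarith
    _ ≤ SU + K * D₀ * t ^ 2 * N := by linarith

end PocketClassicalStability

open PocketClassicalStability in
/-- **S1 `stub_pocketClassicalStability` — classical stability of the pocket potential.**
For a smooth-class `v` (repulsive finite range, finite, `C²` as `ṽ(x) = v(|x|)`, edge condition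
`‖D²ṽ‖ ≤ Cₑ√ṽ`) with a positive soft core (`0 < v 0`) and range `R₀`, the Puff weight profile
`W(r) = r² ‖D²ṽ(r e₀)‖` satisfies: there are `t₁ > 0`, `B ≥ 0` such that for all `0 < t ≤ t₁`
and every configuration of any number `N` of points in `ℝ³`,
`t ∑_{i<j} W(|xᵢ-xⱼ|) ≤ ∑_{i<j} v(|xᵢ-xⱼ|) + B t² N` — i.e. the pocket potential `v − tW` is
classically stable (Lee 2009, Def. 2) with constant `B t²`. Proof: `profile_bounds` (edge
condition + AM–GM: `tW ≤ v/4 + D₀t²1_{[0,R₀]}`, core `v ≥ v₀` on `[0,r₁)`), `pair_count_le`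
(cube counting: `#{i<j : |xᵢⱼ| ≤ R₀} ≤ K(#{i<j : |xᵢⱼ| < r₁} + N)`), `real_stability`, and the
`ℝ≥0∞` bookkeeping `interaction_ofReal`. Sources: J. O. Lee, J. Stat. Phys. 134 (2009)
= arXiv:0803.0533, Def. 2; D. Ruelle, *Statistical Mechanics* (1969) §3.2; card
`Ideas/coupling-slope-pocket.md`, Tier 1. -/
theorem stub_pocketClassicalStability :
    ∀ v : ℝ → ℝ≥0∞, IsRepulsiveFiniteRange v → (∀ r, v r ≠ ⊤) →
      ContDiff ℝ 2 (fun x : Space => (v ‖x‖).toReal) →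
      (∃ Cₑ : ℝ, ∀ x : Space, ‖iteratedFDeriv ℝ 2 (fun x : Space => (v ‖x‖).toReal) x‖
          ≤ Cₑ * Real.sqrt ((v ‖x‖).toReal)) →
      0 < v 0 → ∀ R₀ : ℝ, 0 < R₀ → (∀ r, R₀ < r → v r = 0) →
      ∃ t₁ B : ℝ, 0 < t₁ ∧ 0 ≤ B ∧ ∀ t : ℝ, 0 < t → t ≤ t₁ → ∀ N : ℕ, ∀ X : Config N,
        ENNReal.ofReal t *
            interaction (fun r : ℝ => ENNReal.ofReal (r ^ 2 *
              ‖iteratedFDeriv ℝ 2 (fun x : Space => (v ‖x‖).toReal)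
                (r • EuclideanSpace.single (0 : Fin 3) (1 : ℝ))‖)) X
          ≤ interaction v X + ENNReal.ofReal (B * t ^ 2 * N) := by
  intro v _hv hfin hC2 hedge hcore R₀ _hR₀ hrange
  obtain ⟨Cₑ, hCₑ⟩ := hedge
  obtain ⟨r₁, D₀, v₀, hr₁, hD₀, hv₀, hcoreR, hpt⟩ :=
    profile_bounds v hfin hC2 Cₑ hCₑ hcore R₀ hrange
  obtain ⟨K, hK, hcount⟩ := pair_count_le r₁ R₀ hr₁
  obtain ⟨t₁, B, ht₁, hB, hreal⟩ := real_stability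
    (W := fun r => r ^ 2 * ‖iteratedFDeriv ℝ 2 (fun x : Space => (v ‖x‖).toReal)
      (r • EuclideanSpace.single (0 : Fin 3) (1 : ℝ))‖)
    (U := fun r => (v r).toReal) hD₀ hv₀ hK (fun r => ENNReal.toReal_nonneg) hcoreR hpt hcount
  refine ⟨t₁, B, ht₁, hB, fun t ht htt N X => ?_⟩
  have h := hreal t ht htt N X
  have hV : interaction v X
      = ENNReal.ofReal (∑ i, ∑ j with i < j, (v (dist (X i) (X j))).toReal) := by
    rw [← interaction_ofReal (fun r => (v r).toReal) (fun r => ENNReal.toReal_nonneg) X]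
    congr 1
    funext r
    exact (ENNReal.ofReal_toReal (hfin r)).symm
  have hWnn : ∀ r : ℝ, 0 ≤ r ^ 2 * ‖iteratedFDeriv ℝ 2 (fun x : Space => (v ‖x‖).toReal)
      (r • EuclideanSpace.single (0 : Fin 3) (1 : ℝ))‖ := fun r => by positivity
  have hSnn : 0 ≤ ∑ i, ∑ j with i < j, (v (dist (X i) (X j))).toReal :=
    Finset.sum_nonneg fun i _ => Finset.sum_nonneg fun j _ => ENNReal.toReal_nonneg
  rw [interaction_ofReal _ hWnn X, hV, ← ENNReal.ofReal_mul ht.le,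
    ← ENNReal.ofReal_add hSnn (by positivity)]
  exact ENNReal.ofReal_le_ofReal h

end Summit.AtomisticToContinuum.BoseEinsteinCondensation.Theorems
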